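import Summits.QuantumFields.YangMills.Theorems.UniversalDetectorQ2Adapter
import Summits.QuantumFields.YangMills.Theorems.LangevinControlUVOSLegsFromFemtoAndGapStubCollar
import Literature.MathematicalPhysics.QuantumFieldTheory.QCDTimeReflection
import Literature.MathematicalPhysics.QuantumLattice.EuclideanAction

/-!
# Route `UniversalDetector`, support item `PlaneLimitExtraction` (stmt-QuantumFields-23251) — `Q2(ϑw, w)` as the
reflected-pair Riemann sum, and the positivity adapter with a vanishing defect

Ideator seat ym-idea-8 g7 (LINE 4 of rung R2a = `BalabanLadder.NT`).  The reflection-positivity clause of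
`PlaneLimitExtraction` is reached from the lattice as follows: `Q2 β L s (ϑw) w` is, after the reindexing
`x ↦ ϑx` of the box (`Q2_thetaTest_eq`; `timeReflection_smul_siteToE`, `siteReflect_mem_box`), exactly the
reflected-pair sum `Σ_{x,y} w(sx) w(sy) Cov_T(dens y, dens (ϑx))` of `UniversalDetectorMirrorPositivity`
(`abs_riemannMirror_sub_mirrorCov_le`), restricted to the charged window (`sum_box_mul_mul_eq_sum_filter`); that
sum is within `36 ε (Σ|w(sx)|)²` (`sum_abs_mul_abs_mul_const`) of the mirror form, which is `≥ 0` on every odd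
torus; with `ε = s⁸ ω(s)` from (TIGHT6) (`abs_sub_eq_pow_mul_abs_sub_scaled`) and the uniform Riemann bound of the
g4 toolkit the defect is `o(1)`, and `ge_of_tendsto_of_neg_le` / `integral_nonneg_of_Q2_ge_neg` (the `≥ -δ_k`
variant of `integral_nonneg_of_Q2_nonneg`) give `0 ≤ ∫∫ ϑw(x) w(y) K(y - x)`.  No summit, rung or crux is proved.
-/

set_option autoImplicit false

noncomputable section

open scoped SchwartzMap
open MeasureTheory Filter Topology Finset
open Literature.MathematicalPhysics.QuantumFieldTheory Literature.MathematicalPhysics.QuantumLattice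
  Literature.Probability.LatticeModels
open Summit.QuantumFields.YangMills.Cruxes.OSLegsFromFemtoAndGap.DlrCollarTransfer
open Summit.QuantumFields.YangMills.Cruxes.UniversalDetectorLimitExtraction (tendsto_Q2_of_near_kernel)

namespace Summit.QuantumFields.YangMills.Cruxes.UniversalDetectorPlaneTight

variable {G : Type} [Group G] [TopologicalSpace G] [IsTopologicalGroup G] [CompactSpace G]
  [MeasurableSpace G] [BorelSpace G] (r : LatticeRep G)

/-! ## The reflection on lattice points read in physical units -/

omit [Group G] [TopologicalSpace G] [IsTopologicalGroup G] [CompactSpace G] [MeasurableSpace G] [BorelSpace G] r in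
/-- `ϑ(s x) = s (ϑ_site x)` for lattice points. -/
theorem timeReflection_smul_siteToE (s : ℝ) (x : Site 4) :
    timeReflection 4 (s • siteToE x) = s • siteToE (siteReflect x) := by
  ext i
  rw [timeReflection_apply]
  by_cases hi : i = 0
  · subst hi
    simp [siteToE_apply, siteReflect_apply_zero]
  · simp [hi, siteToE_apply, siteReflect_apply_of_ne _ hi]

omit [Group G] [TopologicalSpace G] [IsTopologicalGroup G] [CompactSpace G] [MeasurableSpace G] [BorelSpace G] r in
/-- The site reflection preserves the box. -/
theorem siteReflect_mem_box {L : ℕ} {x : Site 4} (hx : x ∈ box 4 L) : siteReflect x ∈ box 4 L := by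
  rw [mem_box] at hx ⊢
  intro i
  by_cases hi : i = 0
  · subst hi
    rw [siteReflect_apply_zero]
    constructor <;> linarith [(hx 0).1, (hx 0).2]
  · rw [siteReflect_apply_of_ne _ hi]
    exact hx i

/-! ## `Q2(ϑw, w)` is the reflected-pair sum -/

/-- **`Q2 (ϑw) w` as the reflected-pair Riemann sum** (reindex `x ↦ ϑx`; covariance symmetric). -/
theorem Q2_thetaTest_eq (β : ℝ) (L : ℕ) (s : ℝ) (w : 𝓢(EuclideanSpace ℝ (Fin 4), ℝ)) :
    Q2 G r β L s (thetaTest 4 w) w = ∑ x ∈ box 4 L, ∑ y ∈ box 4 L, w (s • siteToE x) * w (s • siteToE y) *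
      (torusE G r β L (fun V => dens G r y V * dens G r (siteReflect x) V) -
        torusE G r β L (dens G r y) * torusE G r β L (dens G r (siteReflect x))) := by
  unfold Q2
  refine Finset.sum_nbij' siteReflect siteReflect (fun x hx => siteReflect_mem_box hx)
    (fun x hx => siteReflect_mem_box hx) (fun x _ => siteReflect_siteReflect x) (fun x _ => siteReflect_siteReflect x)
    (fun x _ => ?_)
  simp only [siteReflect_siteReflect, thetaTest_apply, timeReflection_smul_siteToE]
  refine Finset.sum_congr rfl fun y _ => ?_
  have hc : (fun V => dens G r x V * dens G r y V) = fun V => dens G r y V * dens G r x V := by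
    funext V; ring
  rw [hc, mul_comm (torusE G r β L (dens G r x)) (torusE G r β L (dens G r y))]

omit [Group G] [TopologicalSpace G] [IsTopologicalGroup G] [CompactSpace G] [MeasurableSpace G] [BorelSpace G] r in
/-- **Restriction to the charged window**: if the weight vanishes off `P`, the double box sum is the double sum over
`(box 4 L).filter P`. -/
theorem sum_box_mul_mul_eq_sum_filter (L : ℕ) (c : Site 4 → ℝ) (K : Site 4 → Site 4 → ℝ) (P : Site 4 → Prop)
    [DecidablePred P] (hc : ∀ x ∈ box 4 L, ¬ P x → c x = 0) :
    ∑ x ∈ box 4 L, ∑ y ∈ box 4 L, c x * c y * K x y =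
      ∑ x ∈ (box 4 L).filter P, ∑ y ∈ (box 4 L).filter P, c x * c y * K x y := by
  rw [Finset.sum_filter]
  refine Finset.sum_congr rfl fun x hx => ?_
  by_cases hPx : P x
  · rw [if_pos hPx, Finset.sum_filter]
    refine Finset.sum_congr rfl fun y hy => ?_
    by_cases hPy : P y
    · rw [if_pos hPy]
    · rw [if_neg hPy, hc y hy hPy]; ring
  · rw [if_neg hPx]
    refine Finset.sum_eq_zero fun y _ => ?_
    rw [hc x hx hPx]; ring

omit [Group G] [TopologicalSpace G] [IsTopologicalGroup G] [CompactSpace G] [MeasurableSpace G] [BorelSpace G] r in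
/-- **The defect sum with a constant one-step bound**: `Σ_{x,y} |c x| |c y| Σ_{p,q} E = 36 E (Σ |c|)²`
(six valid plane orientations). -/
theorem sum_abs_mul_abs_mul_const (X : Finset (Site 4)) (c : Site 4 → ℝ) (E : ℝ) :
    ∑ x ∈ X, ∑ y ∈ X, |c x| * |c y| *
        ∑ _p : {q : Fin 4 × Fin 4 // q.1 < q.2}, ∑ _q : {q : Fin 4 × Fin 4 // q.1 < q.2}, E =
      36 * E * (∑ x ∈ X, |c x|) ^ 2 := by
  have hcard : Fintype.card {q : Fin 4 × Fin 4 // q.1 < q.2} = 6 := by decide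
  simp only [Finset.sum_const, Finset.card_univ, hcard, nsmul_eq_mul, Nat.cast_ofNat]
  rw [sq, Finset.sum_mul_sum, Finset.mul_sum]
  refine Finset.sum_congr rfl fun x _ => ?_
  rw [Finset.mul_sum]
  refine Finset.sum_congr rfl fun y _ => ?_
  ring

omit [Group G] [TopologicalSpace G] [IsTopologicalGroup G] [CompactSpace G] [MeasurableSpace G] [BorelSpace G] r in
/-- Covariance-level differences from kernel-level ones: `|A - B| = s⁸ |s⁻⁸A - s⁻⁸B|` (`s ≠ 0`). -/
theorem abs_sub_eq_pow_mul_abs_sub_scaled {s : ℝ} (hs : s ≠ 0) (A B : ℝ) :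
    |A - B| = s ^ 8 * |s⁻¹ ^ 8 * A - s⁻¹ ^ 8 * B| := by
  rw [← mul_sub, abs_mul, ← mul_assoc, abs_of_nonneg (by positivity : (0 : ℝ) ≤ s⁻¹ ^ 8), inv_pow,
    mul_inv_cancel₀ (pow_ne_zero 8 hs), one_mul]

/-! ## Positivity in the limit with a vanishing defect -/

omit [Group G] [TopologicalSpace G] [IsTopologicalGroup G] [CompactSpace G] [MeasurableSpace G] [BorelSpace G] r in
/-- If `u_k → I`, `δ_k → 0` and eventually `-δ_k ≤ u_k`, then `0 ≤ I`. -/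
theorem ge_of_tendsto_of_neg_le {u δ : ℕ → ℝ} {I : ℝ} (hu : Tendsto u atTop (𝓝 I))
    (hδ : Tendsto δ atTop (𝓝 0)) (h : ∀ᶠ k in atTop, -δ k ≤ u k) : 0 ≤ I := by
  have h2 : Tendsto (fun k => u k + δ k) atTop (𝓝 (I + 0)) := hu.add hδ
  rw [add_zero] at h2
  exact ge_of_tendsto h2 (h.mono fun k hk => by linarith)

/-- **Adapter for the reflection-positivity conjunct with a vanishing lattice defect.**  Under the hypotheses of
`tendsto_Q2_of_near_kernel` (g4 toolkit), eventual `-δ_k ≤ Q2 β_k L_k s_k w₁ w₂` with `δ_k → 0` (for the route: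
`w₁ = ϑ w₂`; `Q2(ϑw, w)` = mirror form `≥ 0` up to the reflected-density defect `δ_k = 36 s_k⁸ ω(s_k) (Σ|w|)²`)
gives `0 ≤ ∫ x, ∫ y, w₁ x * w₂ y * K (y - x)`. -/
theorem integral_nonneg_of_Q2_ge_neg (w₁ w₂ : 𝓢(EuclideanSpace ℝ (Fin 4), ℝ))
    (K : EuclideanSpace ℝ (Fin 4) → ℝ) (t₀ : ℝ) (ht₀ : 0 < t₀)
    (h₁ : tsupport (w₁ : EuclideanSpace ℝ (Fin 4) → ℝ) ⊆ {y | t₀ ≤ -(y 0)})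
    (h₂ : tsupport (w₂ : EuclideanSpace ℝ (Fin 4) → ℝ) ⊆ {y | t₀ ≤ y 0})
    (hKc : ContinuousOn K {z | z ≠ 0}) (hKb : ∀ η : ℝ, 0 < η → ∃ C : ℝ, ∀ z, η ≤ ‖z‖ → |K z| ≤ C)
    (β : ℕ → ℝ) (L : ℕ → ℕ) (s : ℕ → ℝ) (hs : ∀ k, 0 < s k) (hs0 : Tendsto s atTop (𝓝 0))
    (hL : Tendsto (fun k => s k * L k) atTop atTop) (M : ℝ)
    (hM : ∀ᶠ k in atTop, ∀ x ∈ box 4 (L k), ∀ x' ∈ box 4 (L k),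
      w₁ (s k • siteToE x) ≠ 0 → w₂ (s k • siteToE x') ≠ 0 →
      |(s k)⁻¹ ^ 8 * (torusE G r (β k) (L k) (fun U => dens G r x U * dens G r x' U)
          - torusE G r (β k) (L k) (dens G r x) * torusE G r (β k) (L k) (dens G r x'))
        - K (s k • siteToE x' - s k • siteToE x)| ≤ M)
    (hnear : ∀ R ε : ℝ, 0 < R → 0 < ε → ∀ᶠ k in atTop, ∀ x ∈ box 4 (L k), ∀ x' ∈ box 4 (L k),
      ‖s k • siteToE x‖ ≤ R → ‖s k • siteToE x'‖ ≤ R →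
      w₁ (s k • siteToE x) ≠ 0 → w₂ (s k • siteToE x') ≠ 0 →
      |(s k)⁻¹ ^ 8 * (torusE G r (β k) (L k) (fun U => dens G r x U * dens G r x' U)
          - torusE G r (β k) (L k) (dens G r x) * torusE G r (β k) (L k) (dens G r x'))
        - K (s k • siteToE x' - s k • siteToE x)| ≤ ε)
    (δ : ℕ → ℝ) (hδ : Tendsto δ atTop (𝓝 0))
    (hpos : ∀ᶠ k in atTop, -δ k ≤ Q2 G r (β k) (L k) (s k) w₁ w₂) :
    0 ≤ ∫ x, ∫ y, w₁ x * w₂ y * K (y - x) :=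
  ge_of_tendsto_of_neg_le (tendsto_Q2_of_near_kernel G r w₁ w₂ K t₀ ht₀ h₁ h₂ hKc hKb β L s hs hs0 hL M hM hnear)
    hδ hpos

end Summit.QuantumFields.YangMills.Cruxes.UniversalDetectorPlaneTight

end
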